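import Summits.ResolutionOfSingularities.ResolutionOfSingularities.Theorems.RadicialJungCleanModelsCcurveQuotientDVR
import Summits.ResolutionOfSingularities.ResolutionOfSingularities.Theorems.RadicialJungCleanModelsCcurvePointPrepWeak
import Summits.ResolutionOfSingularities.ResolutionOfSingularities.Theorems.RadicialJungCleanModelsCleanLU3CompositeCdiv
import Summits.ResolutionOfSingularities.ResolutionOfSingularities.Theorems.RadicialJungCleanModelsCleanLU3CompositeFormOneLift
import HarnessLib

/-!
# Route `RadicialJung`, crux `CleanModels` (stmt-15917) — (C-curve) sub-line: preliminaries for the closed-point persist (`stub_Cc_persistForm1/3`)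

Lead `res-B-lead-1` g7 (plan `Cruxes/CleanModels/Lines/Sketch-memo-Ccurve-plan.md` §1 S5; workfile `Lines/Sketch_Ccurve_assembly.lean` v2.8).
OURS · counted 0.  Nothing here proves resolution in characteristic `p`; resolution in char `p` is NOT proved.

Bricks shared by the form-(1) and form-(3) persist steps:
* `exists_eq_unit_mul_pow_add` — in a regular local ring `S` with regular system of parameters `(x, y, z)`, an element `γ ∉ (x, y)` is
  `U · z^e + x · a + y · b` with `U` a unit (`S ⧸ (x, y)` is a DVR with uniformizer `z̄`, ✓ `quotient_span_pair_dvr`);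
* `isUnit_locAtCentre_iff` — units of `locAtCentre B O` are the elements of `O`-value `1`;
* `valuation_add_eq_one_of_lt` — unit + non-unit is a unit, in valuation form;
* `sum_mul_pow_rescale`, `exists_ne_zero_mul_of_exists` — `K^p`-rescaling of a representative `Σ c_j^p g₀^j` of the `K^p`-line of `g₀`;
* `mem_span_pair_iff_exists` — membership in `(x, y) ⊆ locAtCentre B O` as an equation in `K`.
-/

noncomputable section

set_option linter.dupNamespace false

open IsLocalRing Literature.AlgebraicGeometry.Resolution
open Summit.ResolutionOfSingularities.ResolutionOfSingularities.Theorems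

namespace Summit.ResolutionOfSingularities.ResolutionOfSingularities.Theorems.RadicialJung.CleanModels.Ccurve

/-- **DVR decomposition off the curve.**  In a regular local ring `S` with regular system of parameters `(x, y, z)`, every `γ ∉ (x, y)` is
`U · z ^ e + x · a + y · b` with `U` a unit: the quotient `S ⧸ (x, y)` (the local ring of the regular curve `V(x, y)`) is a discrete valuation ring
with uniformizer the image of `z`. [folklore] -/
theorem exists_eq_unit_mul_pow_add {S : Type} [CommRing S] [IsRegularLocalRing S]
    (hd : (maximalIdeal S).spanFinrank = 3) (x y z : S) (hxyz : Ideal.span ({x, y, z} : Set S) = maximalIdeal S)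
    (γ : S) (hγ : γ ∉ Ideal.span ({x, y} : Set S)) :
    ∃ (e : ℕ) (U a b : S), IsUnit U ∧ γ = U * z ^ e + x * a + y * b := by
  classical
  set P : Ideal S := Ideal.span ({x, y} : Set S) with hP
  let t : Fin 3 → S := ![x, y, z]
  have ht : Ideal.span (Set.range t) = maximalIdeal S := by
    rw [← hxyz]; congr 1; ext a; simp only [t, Set.mem_range, Set.mem_insert_iff, Set.mem_singleton_iff]
    constructor
    · rintro ⟨i, rfl⟩; fin_cases i <;> simp
    · rintro (rfl | rfl | rfl)
      exacts [⟨0, rfl⟩, ⟨1, rfl⟩, ⟨2, rfl⟩]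
  obtain ⟨hdom, hdvr, hz⟩ := quotient_span_pair_dvr hd t ht
  change IsDomain (S ⧸ P) at hdom
  change IsDiscreteValuationRing (S ⧸ P) at hdvr
  change Irreducible (Ideal.Quotient.mk P z) at hz
  haveI := hdom
  haveI := hdvr
  have hγ0 : Ideal.Quotient.mk P γ ≠ 0 := by
    rwa [Ne, Ideal.Quotient.eq_zero_iff_mem]
  obtain ⟨e, u, hu⟩ := IsDiscreteValuationRing.eq_unit_mul_pow_irreducible hγ0 hz
  obtain ⟨U, hU⟩ := Ideal.Quotient.mk_surjective (u : S ⧸ P)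
  haveI : IsLocalHom (Ideal.Quotient.mk P) := IsLocalHom.of_surjective _ Ideal.Quotient.mk_surjective
  have hUunit : IsUnit U := isUnit_of_map_unit (Ideal.Quotient.mk P) U (by rw [hU]; exact u.isUnit)
  have hmem : γ - U * z ^ e ∈ P := by
    rw [← Ideal.Quotient.eq, map_mul, map_pow, hU]
    exact hu
  obtain ⟨a, b, hab⟩ := Ideal.mem_span_pair.mp hmem
  refine ⟨e, U, a, b, hUunit, ?_⟩
  have h1 : γ = U * z ^ e + (γ - U * z ^ e) := by ring
  rw [h1, ← hab]; ring

variable {K : Type} [Field K]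

/-- Units of `locAtCentre B O` (`B ⊆ O`) are exactly its elements of `O`-value `1`. [folklore] -/
theorem isUnit_locAtCentre_iff {B : Subring K} {O : ValuationSubring K} (h : B ≤ O.toSubring) (w : ↥(locAtCentre B O)) :
    IsUnit w ↔ O.valuation (w : K) = 1 := by
  have hle : O.valuation (w : K) ≤ 1 := (O.valuation_le_one_iff _).mpr (locAtCentre_le h w.2)
  constructor
  · intro hw
    by_contra hne
    exact ((not_isUnit_locAtCentre_iff h w).mpr (lt_of_le_of_ne hle hne)) hw
  · intro hw
    by_contra hnu
    exact absurd ((not_isUnit_locAtCentre_iff h w).mp hnu) (by rw [hw]; exact lt_irrefl _)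

/-- A `K`-element of `O`-value `1` lying in `locAtCentre B O` is a unit there (membership form of `isUnit_locAtCentre_iff`). [folklore] -/
theorem isUnit_locAtCentre_of_valuation_eq_one {B : Subring K} {O : ValuationSubring K} (h : B ≤ O.toSubring) {w : K}
    (hw : w ∈ locAtCentre B O) (hv : O.valuation w = 1) : IsUnit (⟨w, hw⟩ : ↥(locAtCentre B O)) :=
  (isUnit_locAtCentre_iff h ⟨w, hw⟩).mpr hv

/-- Unit plus non-unit is a unit, in valuation form: `v U = 1`, `v m < 1` ⇒ `v (U + m) = 1`. [folklore] -/
theorem valuation_add_eq_one_of_lt (O : ValuationSubring K) {U m : K} (hU : O.valuation U = 1) (hm : O.valuation m < 1) :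
    O.valuation (U + m) = 1 := by
  rw [Valuation.map_add_eq_of_lt_left _ (by rw [hU]; exact hm), hU]

/-- An element of value `< 1` times an element of value `≤ 1` has value `< 1`. [folklore] -/
theorem valuation_mul_lt_one_of_lt_of_mem (O : ValuationSubring K) {a b : K} (ha : O.valuation a < 1) (hb : b ∈ O) :
    O.valuation (a * b) < 1 := by
  rw [map_mul]
  calc O.valuation a * O.valuation b ≤ O.valuation a * 1 := by
        gcongr; exact (O.valuation_le_one_iff _).mpr hb
    _ < 1 := by rw [mul_one]; exact ha

/-- `K^p`-rescaling of a representative of the `K^p`-line of `g₀`: `Σ (c_j f)^p g₀^j = f^p · Σ c_j^p g₀^j`. [folklore] -/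
theorem sum_mul_pow_rescale (p : ℕ) (g₀ f : K) (c : Fin p → K) :
    (∑ j : Fin p, (c j * f) ^ p * g₀ ^ (j : ℕ)) = f ^ p * ∑ j : Fin p, c j ^ p * g₀ ^ (j : ℕ) := by
  rw [Finset.mul_sum]
  refine Finset.sum_congr rfl fun j _ => ?_
  rw [mul_pow]; ring

/-- Rescaling by a nonzero `f` keeps a nonzero coefficient of positive index. [folklore] -/
theorem exists_ne_zero_mul_of_exists {p : ℕ} {c : Fin p → K} (hc : ∃ j : Fin p, (j : ℕ) ≠ 0 ∧ c j ≠ 0) {f : K} (hf : f ≠ 0) :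
    ∃ j : Fin p, (j : ℕ) ≠ 0 ∧ c j * f ≠ 0 := by
  obtain ⟨j, hj, hcj⟩ := hc
  exact ⟨j, hj, mul_ne_zero hcj hf⟩

/-- Membership in the ideal `(x, y)` of a subring of `K`, as an equation in `K`. [folklore] -/
theorem mem_span_pair_iff_exists {R : Subring K} {w x y : K} (hw : w ∈ R) (hx : x ∈ R) (hy : y ∈ R) :
    (⟨w, hw⟩ : ↥R) ∈ Ideal.span ({⟨x, hx⟩, ⟨y, hy⟩} : Set ↥R) ↔ ∃ a b : K, a ∈ R ∧ b ∈ R ∧ w = x * a + y * b := by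
  constructor
  · intro h
    obtain ⟨a, b, hab⟩ := Ideal.mem_span_pair.mp h
    refine ⟨a, b, a.2, b.2, ?_⟩
    have := congrArg Subtype.val hab
    simp only [Subring.coe_add, Subring.coe_mul] at this
    rw [← this]; ring
  · rintro ⟨a, b, ha, hb, hwab⟩
    refine Ideal.mem_span_pair.mpr ⟨⟨a, ha⟩, ⟨b, hb⟩, Subtype.ext ?_⟩
    simp only [Subring.coe_add, Subring.coe_mul]
    rw [hwab]; ring

/-- The value-`1` characterisation of «off the centre curve»: under the curve characterisation `hcen` of `(x, y) ⊆ S' = locAtCentre B' O`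
(`v₁ w < 1 ↔ w ∈ (x, y)`), an element of `S'` lies outside `(x, y)` iff its `O₁`-value is `1`. [folklore] -/
theorem not_mem_span_pair_iff_valuation_eq_one {B' : Subring K} {O O₁ : ValuationSubring K} (hB'O : B' ≤ O.toSubring) (hOO₁ : O ≤ O₁)
    {x y : K} (hx : x ∈ locAtCentre B' O) (hy : y ∈ locAtCentre B' O)
    (hcen : ∀ w : ↥(locAtCentre B' O), O₁.valuation (w : K) < 1 ↔ w ∈ Ideal.span ({⟨x, hx⟩, ⟨y, hy⟩} : Set ↥(locAtCentre B' O)))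
    (w : ↥(locAtCentre B' O)) :
    w ∉ Ideal.span ({⟨x, hx⟩, ⟨y, hy⟩} : Set ↥(locAtCentre B' O)) ↔ O₁.valuation (w : K) = 1 := by
  have hle : O₁.valuation (w : K) ≤ 1 := (O₁.valuation_le_one_iff _).mpr (hOO₁ (locAtCentre_le hB'O w.2))
  rw [← hcen w]
  constructor
  · intro h; exact le_antisymm hle (not_lt.mp h)
  · intro h; rw [h]; exact lt_irrefl _

/-- **DVR decomposition off the curve, `K`-level form at `S' = locAtCentre B' O`.**  With r.s.p. `(x, y, z)` of `S'` and the curve characterisation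
`hcen`, every `γ ∈ S'` of `O₁`-value `1` is `U · z^e + x · a + y · b` with `U, a, b ∈ S'` and `O.valuation U = 1`. [folklore] -/
theorem exists_eq_unit_mul_pow_add_K {B' : Subring K} {O O₁ : ValuationSubring K} (hB'O : B' ≤ O.toSubring) (hOO₁ : O ≤ O₁)
    [IsRegularLocalRing ↥(locAtCentre B' O)] (hdim : ringKrullDim ↥(locAtCentre B' O) = 3)
    {x y z : K} (hx : x ∈ locAtCentre B' O) (hy : y ∈ locAtCentre B' O) (hz : z ∈ locAtCentre B' O)
    (hmax : (haveI := isLocalRing_locAtCentre hB'O; IsLocalRing.maximalIdeal (locAtCentre B' O)) =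
        Ideal.span {⟨x, hx⟩, ⟨y, hy⟩, ⟨z, hz⟩})
    (hcen : ∀ w : ↥(locAtCentre B' O), O₁.valuation (w : K) < 1 ↔ w ∈ Ideal.span ({⟨x, hx⟩, ⟨y, hy⟩} : Set ↥(locAtCentre B' O)))
    {γ : K} (hγ : γ ∈ locAtCentre B' O) (hvγ : O₁.valuation γ = 1) :
    ∃ (e : ℕ) (U a b : K), U ∈ locAtCentre B' O ∧ a ∈ locAtCentre B' O ∧ b ∈ locAtCentre B' O ∧ O.valuation U = 1 ∧
      γ = U * z ^ e + x * a + y * b := by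
  haveI := isLocalRing_locAtCentre hB'O
  have hd : (maximalIdeal ↥(locAtCentre B' O)).spanFinrank = 3 := spanFinrank_eq_three_of_dim _ hdim
  have hγ' : (⟨γ, hγ⟩ : ↥(locAtCentre B' O)) ∉ Ideal.span ({⟨x, hx⟩, ⟨y, hy⟩} : Set ↥(locAtCentre B' O)) :=
    (not_mem_span_pair_iff_valuation_eq_one hB'O hOO₁ hx hy hcen ⟨γ, hγ⟩).mpr hvγ
  obtain ⟨e, U, a, b, hU, hrel⟩ := exists_eq_unit_mul_pow_add hd ⟨x, hx⟩ ⟨y, hy⟩ ⟨z, hz⟩ hmax.symm ⟨γ, hγ⟩ hγ'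
  refine ⟨e, U, a, b, U.2, a.2, b.2, (isUnit_locAtCentre_iff hB'O U).mp hU, ?_⟩
  have := congrArg Subtype.val hrel
  simpa using this

end Summit.ResolutionOfSingularities.ResolutionOfSingularities.Theorems.RadicialJung.CleanModels.Ccurve

end
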